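import Summits.RiemannHypothesis.RiemannHypothesis.Theorems.SignConeOscSingleWindowPWCertificate
import Summits.RiemannHypothesis.RiemannHypothesis.Theorems.SignConePointwiseCertThirteenTenths
import Summits.RiemannHypothesis.RiemannHypothesis.Theorems.SignConeSignConeOscillatoryUpToThirteenTenths

/-!
# `GapRung 1`, regime `n₀ ≤ 12`: erasure with the plain certificate `pwCert13s` (near-clean rung `13/5`)
(crux `SignConeInequality`, stmt-RiemannHypothesis-16301; cell `Cruxes/SignConeInequality/`, rung `GapRung 1`, registered
stub `stub_gap_small` (`2 ≤ n₀ ≤ 11`) of line `gap-rung-one`)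

The landed pointwise certificate `pwCert13s` of the cutoff rung `13/10` (`pwCert13s_F_nonneg`: density `≥ 0` for all
real `y`, NO Dirichlet-SOS tail) has kernel `E_χ = (e^{|x|/2} + e^{-|x|/2}) χ(|x|)` with plateau `χ = 1` on `[0, 13/5]` and
knot values `≤ 1` (in fact in `[-1.11, 0.54]`), so `E_χ ≤ e^{x/2} + e^{-x/2}` everywhere (`PWKernel.kernelE_le`, landed for
`OscSingleWindow`).  By the landed erasure identity (`neg_slack_le_sub_erasure_of_density_nonneg`,
`SignConeOscSingleWindowCertificateSuffices.lean`: Parseval with an `L¹` kernel plus the erased remainder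
`∫ Re G · (e^{x/2} + e^{-x/2} − E)`, no support condition) this certificate proves the unit-slack inequality
`-Re F(0) ≤ Re W_ar(F)` for EVERY node-nonnegative autocorrelation sum `F = Σᵢ gᵢ ⋆ g̃ᵢ` with `Re F ≥ 0` on `|x| > 13/5`,
at EVERY cutoff (`unitSlack_of_clean_beyond_thirteen_fifths` — the near-clean rung `NearCleanRung (13/5)` of the
cell's graded families): the erased remainder is `≥ 0` because pointwise either nothing is erased (`|x| ≤ 13/5`, plateau) or
`Re F(x) ≥ 0` (`neg_re_apply_zero_le_re_weilArchPolar_of_erasure_pointwise`).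
A single dirty node gap `[log n₀, log(n₀+1))` with `n₀ ≤ 12` lies below `log 13 < 13/5`, whence `singleGap_erasure`
(`n₀ ≤ 12`, every cutoff) and the registered stub `stub_gap_small` (file `SignConeGapRungOneStubGapSmall.lean`).
What the dirty gap costs here: nothing beyond the cutoff-`13/10` certificate — its taper already pays for arbitrary
sign patterns below `2b = 13/5` and its knot values happen to be `≤ 1`; the tail certificates `pwCert75`/`pwCert32`
(`b = 7/5`, `3/2`) carry Dirichlet-SOS corrections with frequencies beyond `2b` and do NOT transfer to arbitrary cutoffs
this way.
-/

noncomputable section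

-- `Summit.RiemannHypothesis.RiemannHypothesis.…` repeats a namespace component by design (D-0017 layout).
set_option linter.dupNamespace false

open scoped BigOperators ComplexConjugate Real Topology
open Complex MeasureTheory Set Filter

namespace Summit.RiemannHypothesis.RiemannHypothesis.Theorems.SignCone

open Literature.NumberTheory.LFunctions
open Literature.Analysis.SpecialFunctions (reDigammaQuarter)
open Summit.RiemannHypothesis.RiemannHypothesis.Theorems.SignConeOscillatory

section Class

variable {E : ℝ → ℝ} (hEc : Continuous E) (hEs : HasCompactSupport E)
  (hEle : ∀ x : ℝ, E x ≤ Real.exp (x / 2) + Real.exp (-(x / 2)))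
  (nodes : Finset ℕ) (hnodes : ∀ n ∈ nodes, 2 ≤ n) (a : ℕ → ℝ) (ha : ∀ n ∈ nodes, 0 ≤ a n)
  (hD : ∀ y : ℝ, 0 ≤ reDigammaQuarter y - Real.log π + 1 + cosTransform E y -
    ∑ n ∈ nodes, a n * Real.cos (y * Real.log n))
include hEc hEs hEle hnodes ha hD

/-- **An erasure certificate forces the unit-slack inequality wherever its erasure is legal, pointwise.**
Kernel `E ≤ e^{x/2} + e^{-x/2}` (continuous, compact support), weights `a_n ≥ 0` on nodes `n ≥ 2`, density
`Re ψ(1/4+iy/2) − log π + 1 + Ê(y) − Σ_n a_n cos(y log n) ≥ 0`.  Then `-Re F(0) ≤ Re W_ar(F)` for every node-nonnegative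
`F = Σᵢ gᵢ ⋆ g̃ᵢ` (Weil tests `gᵢ`, ANY support) such that at every point either nothing is erased (`E = e^{x/2} + e^{-x/2}`)
or `Re F ≥ 0`. [folklore] -/
theorem neg_re_apply_zero_le_re_weilArchPolar_of_erasure_pointwise
    {k : ℕ} {g : Fin k → ℝ → ℂ} {F : ℝ → ℂ} (hF : F = fun t => ∑ i, weilConv (g i) (weilReflect (g i)) t)
    (hg : ∀ i, IsWeilTest (g i)) (hn : ∀ n : ℕ, 2 ≤ n → 0 ≤ (F (Real.log n)).re)
    (herase : ∀ x : ℝ, E x = Real.exp (x / 2) + Real.exp (-(x / 2)) ∨ 0 ≤ (F x).re) :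
    -(F 0).re ≤ (weilPolarTerm F + weilArchTerm F).re := by
  -- notation
  set P : ℝ → ℝ := fun x => Real.exp (x / 2) + Real.exp (-(x / 2)) with hP
  have hGi : ∀ i, IsWeilTest (weilConv (g i) (weilReflect (g i))) := fun i =>
    (hg i).weilConv (hg i).weilReflect
  -- hermitian symmetry of `F`
  have hsym : ∀ t : ℝ, conj (F (-t)) = F t := by
    intro t
    simp only [hF, map_sum, conj_weilConv_weilReflect_neg]
  have hre_neg : ∀ t : ℝ, (F (-t)).re = (F t).re := fun t => by
    rw [← hsym t, Complex.conj_re]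
  -- `W_ar` and `F(0)` over the sum
  have hA : weilPolarTerm F + weilArchTerm F =
      ∑ i, (weilPolarTerm (weilConv (g i) (weilReflect (g i))) +
        weilArchTerm (weilConv (g i) (weilReflect (g i)))) := by
    rw [hF]
    exact weilArchPolar_finset_sum _ fun i _ => hGi i
  have h0 : (F 0).re = ∑ i, weilNorm2Sq (g i) := re_apply_zero_eq_sum_weilNorm2Sq hF
  -- the node terms, summed over `i`, are `Σ_n (a_n/2) · 2 Re F(log n) ≥ 0`
  have hNsum : ∑ i, (∑ n ∈ nodes, ((a n / 2 : ℝ) : ℂ) *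
      (weilConv (g i) (weilReflect (g i)) (Real.log n) +
        weilConv (g i) (weilReflect (g i)) (-Real.log n))).re =
      ∑ n ∈ nodes, a n / 2 * ((F (Real.log n)).re + (F (-Real.log n)).re) := by
    rw [← Complex.re_sum, Finset.sum_comm]
    rw [Complex.re_sum]
    refine Finset.sum_congr rfl fun n _ => ?_
    rw [← Finset.mul_sum, Complex.re_ofReal_mul, Complex.re_sum]
    congr 1
    rw [hF]
    simp only [Complex.add_re, Complex.re_sum, Finset.sum_add_distrib]
  have hNnonneg : 0 ≤ ∑ n ∈ nodes, a n / 2 * ((F (Real.log n)).re + (F (-Real.log n)).re) := by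
    refine Finset.sum_nonneg fun n hn' => mul_nonneg (by linarith [ha n hn']) ?_
    rw [hre_neg]
    have := hn n (hnodes n hn')
    linarith
  -- the erased remainders, summed over `i`, are `∫ Re F · (P − E) ≥ 0`
  have hRi : ∀ i, Integrable fun x : ℝ =>
      (weilConv (g i) (weilReflect (g i)) x).re * (P x - E x) := by
    intro i
    have hc : Continuous fun x : ℝ => (weilConv (g i) (weilReflect (g i)) x).re :=
      Complex.continuous_re.comp (hGi i).1.continuous
    refine (hc.mul (by rw [hP]; fun_prop)).integrable_of_hasCompactSupport ?_
    exact ((hGi i).2.comp_left Complex.zero_re).mul_right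
  have hRsum : ∑ i, ∫ x : ℝ, (weilConv (g i) (weilReflect (g i)) x).re * (P x - E x) =
      ∫ x : ℝ, (F x).re * (P x - E x) := by
    rw [← integral_finsetSum _ fun i _ => hRi i]
    congr 1 with x
    rw [hF]
    simp only [Complex.re_sum, Finset.sum_mul]
  have hRnonneg : 0 ≤ ∫ x : ℝ, (F x).re * (P x - E x) := by
    refine integral_nonneg fun x => ?_
    show (0 : ℝ) ≤ (F x).re * (P x - E x)
    rcases herase x with hx | hx
    · have hPx : P x - E x = 0 := by rw [hP, hx]; ring
      rw [hPx, mul_zero]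
    · have hPE : 0 ≤ P x - E x := by simp only [hP]; linarith [hEle x]
      exact mul_nonneg hx hPE
  -- the per-test inequalities, summed
  have hsum : -(∑ i, weilNorm2Sq (g i)) ≤
      ∑ i, ((weilPolarTerm (weilConv (g i) (weilReflect (g i))) +
          weilArchTerm (weilConv (g i) (weilReflect (g i))) -
        ∑ n ∈ nodes, ((a n / 2 : ℝ) : ℂ) *
          (weilConv (g i) (weilReflect (g i)) (Real.log n) +
            weilConv (g i) (weilReflect (g i)) (-Real.log n))).re -
        ∫ x : ℝ, (weilConv (g i) (weilReflect (g i)) x).re * (P x - E x)) := by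
    rw [← Finset.sum_neg_distrib]
    refine Finset.sum_le_sum fun i _ => ?_
    have h := neg_slack_le_sub_erasure_of_density_nonneg (hg i) hEc hEs 1 nodes a hD
    rw [one_mul] at h
    exact h
  have key : ∑ i, ((weilPolarTerm (weilConv (g i) (weilReflect (g i))) +
          weilArchTerm (weilConv (g i) (weilReflect (g i))) -
        ∑ n ∈ nodes, ((a n / 2 : ℝ) : ℂ) *
          (weilConv (g i) (weilReflect (g i)) (Real.log n) +
            weilConv (g i) (weilReflect (g i)) (-Real.log n))).re -
        ∫ x : ℝ, (weilConv (g i) (weilReflect (g i)) x).re * (P x - E x)) =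
      (weilPolarTerm F + weilArchTerm F).re -
        ∑ n ∈ nodes, a n / 2 * ((F (Real.log n)).re + (F (-Real.log n)).re) -
        ∫ x : ℝ, (F x).re * (P x - E x) := by
    rw [Finset.sum_sub_distrib, hRsum, ← hNsum, hA, Complex.re_sum, ← Finset.sum_sub_distrib]
    refine congrArg (· - _) (Finset.sum_congr rfl fun i _ => ?_)
    rw [Complex.sub_re]
  rw [h0]
  rw [key] at hsum
  linarith

end Class

/-! ## The plain certificate `pwCert13s` as an erasure certificate -/

/-- The knot values of `pwCert13s` are `≤ 1`. [folklore] -/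
theorem pwCert13s_chiAt_le_one (k : ℕ) : pwCert13s.d.chiAt k ≤ 1 := by
  have hchi : ∀ q ∈ pwCert13s.d.chi, q ≤ 1 := by
    have hall : (pwCert13s.d.chi.all fun q => decide (q ≤ 1)) = true := by decide +kernel
    rw [List.all_eq_true] at hall
    exact fun q hq => of_decide_eq_true (hall q hq)
  unfold PWKernel.chiAt
  rcases lt_or_ge (k - 1) pwCert13s.d.chi.length with hlt | hge
  · rw [List.getD_eq_getElem _ _ hlt]
    exact hchi _ (List.getElem_mem hlt)
  · rw [List.getD_eq_default _ _ hge]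
    exact zero_le_one

/-- **The near-clean rung `13/5` at every cutoff** (cell vocabulary `NearCleanRung (13/5)`): for Weil tests `gᵢ` (ANY
support) and `F = Σᵢ gᵢ ⋆ g̃ᵢ` node-nonnegative with `Re F(x) ≥ 0` for `|x| > 13/5`, `-Re F(0) ≤ Re W_ar(F)` — erasure
with the plain pointwise certificate `pwCert13s` of the cutoff rung `13/10`. [folklore] -/
theorem unitSlack_of_clean_beyond_thirteen_fifths
    {k : ℕ} {g : Fin k → ℝ → ℂ} {F : ℝ → ℂ} (hF : F = fun t => ∑ i, weilConv (g i) (weilReflect (g i)) t)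
    (hg : ∀ i, IsWeilTest (g i)) (hn : ∀ n : ℕ, 2 ≤ n → 0 ≤ (F (Real.log n)).re)
    (hclean : ∀ x : ℝ, 13 / 5 < |x| → 0 ≤ (F x).re) :
    -(F 0).re ≤ (weilPolarTerm F + weilArchTerm F).re := by
  have hh : (0 : ℚ) < pwCert13s.d.h := by show (0 : ℚ) < 1 / 8; norm_num
  have hL : pwCert13s.d.L = 13 / 5 := rfl
  -- erasure is legal and nothing is erased on the plateau `[-13/5, 13/5]`
  have hEle := PWKernel.kernelE_le hh pwCert13s_chiAt_le_one
  have herase : ∀ x : ℝ, pwCert13s.d.kernelE x = Real.exp (x / 2) + Real.exp (-(x / 2)) ∨ 0 ≤ (F x).re := by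
    intro x
    rcases le_or_gt |x| (13 / 5) with hx | hx
    · left
      refine PWKernel.kernelE_eq_of_abs_le hh ?_
      rw [hL]; push_cast; exact hx
    · exact Or.inr (hclean x hx)
  -- the density with slack `1`
  have hD : ∀ y : ℝ, 0 ≤ reDigammaQuarter y - Real.log Real.pi + 1 + cosTransform pwCert13s.d.kernelE y -
      ∑ n ∈ pwCert13s.nodeList.toFinset, (fun n => (pwCert13s.a n : ℝ)) n * Real.cos (y * Real.log n) := by
    intro y
    have h := pwCert13s_F_nonneg y
    unfold PWData.F at h
    have hs : ((pwCert13s.s : ℚ) : ℝ) = 1 := by show (((1 : ℚ)) : ℝ) = 1; norm_num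
    rw [hs] at h
    exact h
  have hnodes : ∀ n ∈ pwCert13s.nodeList.toFinset, 2 ≤ n := by
    intro n hn
    have hall : (pwCert13s.nodeList.all fun m => decide (2 ≤ m)) = true := by decide +kernel
    rw [List.all_eq_true] at hall
    exact of_decide_eq_true (hall n (List.mem_toFinset.1 hn))
  have ha : ∀ n ∈ pwCert13s.nodeList.toFinset, 0 ≤ (fun n => (pwCert13s.a n : ℝ)) n := by
    intro n _
    show (0 : ℝ) ≤ (pwCert13s.a n : ℝ)
    exact_mod_cast pwCert13s_a_nonneg n
  exact neg_re_apply_zero_le_re_weilArchPolar_of_erasure_pointwise pwCert13s.d.continuous_kernelE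
    (PWKernel.hasCompactSupport_kernelE hh) hEle pwCert13s.nodeList.toFinset hnodes (fun n => (pwCert13s.a n : ℝ))
    ha hD hF hg hn herase

/-- `log 13 < 13/5` (`log 13 = 2 log 2 + log 3 + log(13/12) ≤ 2.4849 + 1/12`). [folklore] -/
theorem log_thirteen_lt : Real.log 13 < 13 / 5 := by
  have e : Real.log 13 = 2 * Real.log 2 + Real.log 3 + Real.log (13 / 12) := by
    have h1 : Real.log 13 = Real.log 12 + Real.log (13 / 12) := by
      rw [← Real.log_mul (by norm_num) (by norm_num)]; norm_num
    have h2 : Real.log 12 = 2 * Real.log 2 + Real.log 3 := by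
      rw [show (12 : ℝ) = 2 ^ 2 * 3 by norm_num, Real.log_mul (by norm_num) (by norm_num), Real.log_pow]
      push_cast; ring
    rw [h1, h2]
  have h2 := Real.log_two_lt_d9
  have h3 := Real.log_three_lt_d9
  have h13 : Real.log (13 / 12) ≤ 13 / 12 - 1 := Real.log_le_sub_one_of_pos (by norm_num)
  rw [e]; linarith

/-- **One dirty node gap at `n₀ ≤ 12`, every cutoff** (core of stub `stub_gap_small`): for Weil tests `gᵢ`,
`F = Σᵢ gᵢ ⋆ g̃ᵢ` node-nonnegative whose far-field negativity lies in `log n₀ ≤ |t| < log (n₀ + 1)` with `n₀ ≤ 12`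
(so below `log 13 < 13/5`): `-Re F(0) ≤ Re W_ar(F)`. [folklore] -/
theorem singleGap_erasure {k : ℕ} {g : Fin k → ℝ → ℂ} {F : ℝ → ℂ} {n₀ : ℕ}
    (hF : F = fun t => ∑ i, weilConv (g i) (weilReflect (g i)) t) (hg : ∀ i, IsWeilTest (g i))
    (hn₀ : n₀ ≤ 12) (hn : ∀ n : ℕ, 2 ≤ n → 0 ≤ (F (Real.log n)).re)
    (hgap : ∀ t : ℝ, Real.log 2 ≤ |t| → (F t).re < 0 → Real.log n₀ ≤ |t| ∧ |t| < Real.log (n₀ + 1)) :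
    -(F 0).re ≤ (weilPolarTerm F + weilArchTerm F).re := by
  refine unitSlack_of_clean_beyond_thirteen_fifths hF hg hn fun x hx => ?_
  have hn0R : (n₀ : ℝ) + 1 ≤ 13 := by exact_mod_cast (show n₀ + 1 ≤ 13 by omega)
  have hlog : Real.log ((n₀ : ℝ) + 1) ≤ Real.log 13 := Real.log_le_log (by positivity) hn0R
  have h13 := log_thirteen_lt
  have h2 : Real.log 2 ≤ |x| := by
    have := Real.log_two_lt_d9
    linarith
  by_contra hneg
  push Not at hneg
  have := (hgap x h2 hneg).2
  linarith

end Summit.RiemannHypothesis.RiemannHypothesis.Theorems.SignCone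

end
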